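import Summits.QuantumFields.YangMills.Theorems.BalabanUVNodesN20QuantisedRatioNoRescueAtRecord

/-!
# BalabanUVNodes ∕ N20·N19′ — THE ROWS (Q) ∧ (ACn) IMPLY LAW SEPARATION (LS) WITH AN EXPLICIT SIZE: at a finite class set whose two-run log-ratio `log(B_τ ∕ A_τ)` is D-QUANTISED
# along an integer label up to `ε < D∕4` (Q) with an ANTI-CONCENTRATED label under the run-A weights (ACn), the two across-class laws `S ↦ Σ_S B ∕ Σ_T B`, `S ↦ Σ_S A ∕ Σ_T A`
# are separated by at least `κ(D, m) = (1 − e^{−D∕4})(1 − m(1 + e^{3D∕4}))∕2 ≥ (1 − e^{−D∕4})∕4` on ONE class set (the set where run B's law exceeds run A's); hence at the record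
# the (Q) ∧ (ACn) letter of `…N20QuantisedRatioNoRescue{AtRecord,StubText}` (p606977 ∕ p608022 ∕ p608344) is a SPECIAL CASE of the law-separation letter (LS) of
# `…N19NoDialRescuesLawSeparated` (p608854) ∕ `…N20StubTwoFalseOfLawSeparated`, and the latter's ROWS edition factors through its (LS) edition — CRIT-1's «ONE letter» made kernel

Cell `pub-ymgap`, YM-PLAN Track A (HUMAN RULING D-0062; D-0149 ∕ D-0154, director-ym R399 (3a)); width seat `pub-ymgap-dag-n20-w5` (g2) on node N20 = NE7b; key item K3⁷
`SpineGivenEndpointR13SepCoPH` = stmt-QuantumFields-20544 (`--kind proof --supports 20544 --as helper`); COUNT-NEUTRAL.  Bus: CLAIM-2 ∕ INTENT-2 of g2.  Fifth file of the seat's lineage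
(p606977 → p608022 → p608344 → `…N20StubTwoFalseOfLawSeparated` p610536 → THIS).

WHAT IT SAYS.  §1 (one class set, [folklore]): with `q := Σ_T B ∕ Σ_T A` the MISFIT of p606977 at centre `c = log q` and radius `0` is `Σ_T |B − qA| = 2·(Σ_{S⁺} B − q·Σ_{S⁺} A)` for
`S⁺ = {τ ∈ T : qA_τ ≤ B_τ}`, i.e. `2·Σ_T B · (μ_B(S⁺) − μ_A(S⁺))`; p606977's `sum_misfit_ge_of_quantised_antiConc` bounds it BELOW by `κ·(Σ_T B + q·Σ_T A) = 2κ·Σ_T B` under (Q) ∧ (ACn); so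
`κ ≤ μ_B(S⁺) − μ_A(S⁺)` (★ `exists_classLaw_sub_ge_of_quantised_antiConc`; A6 non-vacuity on p606977's uniform-label toy: `toy_classLaw_separated`).  §2 (along `K`, at dag-n20-d's dial-free
letters `classSet₁₃ ∕ weightA₁₃ ∕ weightB₁₃`): the ROWS text of
p608344 (frequently in `K`, some `|t| ≤ 1`, positive run-A total) ⇒ `∃ s > 0`, dag-n19-w4's `hsep` VERBATIM (★★ `lawSeparated_of_rows`).  Along tuning: at any tuple, «rows NOT eventually
excluded in [I] Thm 2's window» ⇒ «(LS) NOT eventually excluded» (★ `not_forSmallCouplings_lawSeparated_of_rows`), whence the ROWS H-lemma of `…N20StubTwoFalseOfLawSeparated` (p610536 §5,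
`stubTwoText_false_of_stubOneText_of_rows`) IS its (LS) H-lemma (§3, `stubTwoText_false_of_stubOneText_of_lawSeparated`) precomposed with this implication — the subsumption is the
one-line term `stubTwoText_false_of_stubOneText_of_lawSeparated ⟨F, θ, hP, hG, hθ, hB, hE, hlive, not_forSmallCouplings_lawSeparated_of_rows θ hP hrows⟩ h₁` (NOT restated as a theorem
here: the statement is already landed, gate `dedup.landed`).  This file imports only p608022's `…AtRecord` (no stub text is needed).

HONEST FRAMING.  [folklore] finite-sum ∕ real arithmetic on displayed hypothesis SHAPES; decides NEITHER (Q) ∧ (ACn) NOR (LS) at the record ((XG) = def-T-kernel analytic content,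
UNDECIDED; `N20-W5-XG-LOCATED.md` on 20544); proves NO estimate; nothing of Bałaban's asserted or instantiated; NOT a refutation of `stub_expansion13H`; NE7 ∕ NE7b ∕ NE7c NOT
PRINTED for d = 4, NOT proved; N19 ∕ N20 ∕ N21 NOT discharged; K3⁷ OPEN, skeleton v5 941dddb108cbaacf STANDS, not claimed; counts UNMOVED (typed 28∕28 · discharged 5∕27, A 5∕28); no
count claim; no summit statement is proved by this seat; one finite 𝕋⁴ programme at fixed ε, Bałaban AS PRINTED — R4 closes the conditional rung `BalabanLadder.UV` only; the YM mass gap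
(Clay) is NOT proved by any of this; NOT ℝ⁴, NOT OS.  No `def`, no `instance`, no `notation`, no `sorry`; no decl carries a cite tag.
-/

noncomputable section

open Finset Real
open _root_.Filter _root_.Topology

namespace Summit.QuantumFields.YangMills.BalabanUVNodes.N20QuantisedRatioLawSeparation

open Literature.MathematicalPhysics.QuantumFieldTheory.Balaban1983to89
open Literature.MathematicalPhysics.QuantumFieldTheory.Balaban1983to89.T4Continuum
open Literature.MathematicalPhysics.QuantumFieldTheory.Balaban1983to89.Node00
open T4ContinuumYM4Torus (ForSmallCouplings)
open YMDAG.UVSplit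
open Summit.QuantumFields.YangMills.BalabanUVNodes.N20QuantisedRatioNoRescue (sum_misfit_ge_of_quantised_antiConc toy_quantised toy_antiConc)
open Summit.QuantumFields.YangMills.BalabanUVNodes.N21KeyedShellWeightShellZero (weightA₁₃_nonneg)

/-! ## §1 One class set: quantisation + anti-concentration separate the two class laws by `κ(D, m)` -/

section OneStep

variable {ι : Type*} {T : Finset ι} {A B : ι → ℝ}

/-- **THE MISFIT AT A BALANCED RATIO IS TWICE THE POSITIVE EXCESS** [folklore]: for `q` with `q·Σ_T A = Σ_T B`, the two-sided misfit `Σ_T ((B − qA)⁺ + (qA − B)⁺)` equals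
`2·(Σ_{S⁺} B − q·Σ_{S⁺} A)` on `S⁺ = T.filter (qA ≤ B)` — because `Σ_T (B − qA) = 0` makes the negative part's total equal to the positive part's. -/
theorem sum_misfit_zero_radius_eq_two_mul {q : ℝ} [DecidablePred fun τ => q * A τ ≤ B τ] (hbal : q * ∑ τ ∈ T, A τ = ∑ τ ∈ T, B τ) :
    ∑ τ ∈ T, (max (B τ - q * A τ) 0 + max (q * A τ - B τ) 0) =
      2 * (∑ τ ∈ T.filter (fun τ => q * A τ ≤ B τ), B τ - q * ∑ τ ∈ T.filter (fun τ => q * A τ ≤ B τ), A τ) := by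
  have hpos : ∑ τ ∈ T, max (B τ - q * A τ) 0 = ∑ τ ∈ T.filter (fun τ => q * A τ ≤ B τ), (B τ - q * A τ) := by
    rw [Finset.sum_filter]
    refine Finset.sum_congr rfl fun τ _ => ?_
    by_cases h : q * A τ ≤ B τ
    · rw [if_pos h]; exact max_eq_left (by linarith)
    · rw [if_neg h]; exact max_eq_right (by linarith [lt_of_not_ge h])
  have hneg : ∑ τ ∈ T, max (q * A τ - B τ) 0 = ∑ τ ∈ T.filter (fun τ => ¬ q * A τ ≤ B τ), (q * A τ - B τ) := by
    rw [Finset.sum_filter]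
    refine Finset.sum_congr rfl fun τ _ => ?_
    by_cases h : q * A τ ≤ B τ
    · rw [if_neg (not_not_intro h)]; exact max_eq_right (by linarith)
    · rw [if_pos h]; exact max_eq_left (by linarith [lt_of_not_ge h])
  have hzero : ∑ τ ∈ T, (B τ - q * A τ) = 0 := by
    rw [Finset.sum_sub_distrib, ← Finset.mul_sum, hbal, sub_self]
  have hsplit := Finset.sum_filter_add_sum_filter_not T (fun τ => q * A τ ≤ B τ) (fun τ => B τ - q * A τ)
  have hnegsum : ∑ τ ∈ T.filter (fun τ => ¬ q * A τ ≤ B τ), (q * A τ - B τ) =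
      ∑ τ ∈ T.filter (fun τ => q * A τ ≤ B τ), (B τ - q * A τ) := by
    have h1 : ∑ τ ∈ T.filter (fun τ => ¬ q * A τ ≤ B τ), (q * A τ - B τ) =
        -∑ τ ∈ T.filter (fun τ => ¬ q * A τ ≤ B τ), (B τ - q * A τ) := by
      rw [← Finset.sum_neg_distrib]
      exact Finset.sum_congr rfl fun τ _ => by ring
    rw [h1]
    linarith
  rw [Finset.sum_add_distrib, hpos, hneg, hnegsum, Finset.sum_sub_distrib, ← Finset.mul_sum]
  ring

/-- ★ **(Q) ∧ (ACn) ⇒ THE CLASS LAWS ARE `κ`-SEPARATED ON ONE CLASS SET** [folklore].  On a finite class set `T` with `A ≥ 0`, positive run-A total, a D-quantised two-run log-ratio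
along an integer label `v` up to `ε < D∕4` (Q) and no label level carrying more than the fraction `m` of `Σ_T A` (ACn): SOME `S ⊆ T` has
`μ_B(S) − μ_A(S) = Σ_S B ∕ Σ_T B − Σ_S A ∕ Σ_T A ≥ κ(D, m) := (1 − e^{−D∕4})·(1 − m(1 + e^{3D∕4}))∕2`.  Proof: p606977's `sum_misfit_ge_of_quantised_antiConc` at centre `log(Σ_T B ∕ Σ_T A)`,
radius `0`, read through `sum_misfit_zero_radius_eq_two_mul` and divided by `2·Σ_T B > 0`.  No smallness of `m` is needed for the inequality (for `m(1 + e^{3D∕4}) ≤ 1∕2` one has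
`κ ≥ (1 − e^{−D∕4})∕4 > 0`, `kappa_pos`). -/
theorem exists_classLaw_sub_ge_of_quantised_antiConc {v : ι → ℤ} {c₀ D ε m : ℝ} (hD : 0 < D) (hεD : ε < D / 4) (hm : 0 ≤ m)
    (hA : ∀ τ ∈ T, 0 ≤ A τ) (hZA : 0 < ∑ τ ∈ T, A τ)
    (hQ : ∀ τ ∈ T, exp (c₀ + D * (v τ : ℝ) - ε) * A τ ≤ B τ ∧ B τ ≤ exp (c₀ + D * (v τ : ℝ) + ε) * A τ)
    (hAC : ∀ n : ℤ, ∑ τ ∈ T.filter (fun τ => v τ = n), A τ ≤ m * ∑ τ ∈ T, A τ) :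
    ∃ S, S ⊆ T ∧ (1 - exp (-(D / 4))) * ((1 - m * (1 + exp (3 * D / 4))) / 2) ≤
      (∑ τ ∈ S, B τ) / (∑ τ ∈ T, B τ) - (∑ τ ∈ S, A τ) / (∑ τ ∈ T, A τ) := by
  classical
  -- run B's weights are nonnegative and their total is positive
  have hB : ∀ τ ∈ T, 0 ≤ B τ := fun τ hτ => le_trans (mul_nonneg (exp_pos _).le (hA τ hτ)) (hQ τ hτ).1
  have hZB : 0 < ∑ τ ∈ T, B τ := by
    obtain ⟨τ₀, hτ₀, hAτ₀⟩ : ∃ τ ∈ T, 0 < A τ := by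
      by_contra h
      simp only [not_exists, not_and, not_lt] at h
      exact absurd (Finset.sum_nonpos h) (not_le.mpr hZA)
    exact lt_of_lt_of_le (lt_of_lt_of_le (mul_pos (exp_pos _) hAτ₀) (hQ τ₀ hτ₀).1) (Finset.single_le_sum hB hτ₀)
  -- p606977's lower bound at centre `log (Σ_T B / Σ_T A)`, radius 0
  have hmis := sum_misfit_ge_of_quantised_antiConc (c := Real.log ((∑ τ ∈ T, B τ) / ∑ τ ∈ T, A τ)) (r := 0)
    hD le_rfl (by simpa using hεD) hm hA hQ hAC
  set ZA : ℝ := ∑ τ ∈ T, A τ with hZA_def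
  set ZB : ℝ := ∑ τ ∈ T, B τ with hZB_def
  set q : ℝ := ZB / ZA with hq
  set κ : ℝ := (1 - exp (-(D / 4))) * ((1 - m * (1 + exp (3 * D / 4))) / 2) with hκ
  have hq_pos : 0 < q := div_pos hZB hZA
  have hbal : q * ZA = ZB := by rw [hq, div_mul_cancel₀ _ hZA.ne']
  rw [add_zero, sub_zero, Real.exp_log hq_pos, sum_misfit_zero_radius_eq_two_mul hbal, hbal] at hmis
  refine ⟨T.filter (fun τ => q * A τ ≤ B τ), Finset.filter_subset _ _, ?_⟩
  set SB : ℝ := ∑ τ ∈ T.filter (fun τ => q * A τ ≤ B τ), B τ with hSB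
  set SA : ℝ := ∑ τ ∈ T.filter (fun τ => q * A τ ≤ B τ), A τ with hSA
  rw [div_sub_div _ _ hZB.ne' hZA.ne', le_div_iff₀ (mul_pos hZB hZA)]
  have h1 : κ * ZB ≤ SB - q * SA := by linarith
  have h2 := mul_le_mul_of_nonneg_right h1 hZA.le
  have hqA : q * SA * ZA = SA * ZB := by
    calc q * SA * ZA = SA * (q * ZA) := by ring
      _ = SA * ZB := by rw [hbal]
  calc κ * (ZB * ZA) = κ * ZB * ZA := by ring
    _ ≤ (SB - q * SA) * ZA := h2
    _ = SB * ZA - ZB * SA := by rw [sub_mul, hqA]; ring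

/-- `κ(D, m) > 0` under the window condition `m(1 + e^{3D∕4}) ≤ 1∕2` of the rows (then `κ ≥ (1 − e^{−D∕4})∕4`). [folklore] -/
theorem kappa_pos {D m : ℝ} (hD : 0 < D) (hm2 : m * (1 + exp (3 * D / 4)) ≤ 1 / 2) :
    0 < (1 - exp (-(D / 4))) * ((1 - m * (1 + exp (3 * D / 4))) / 2) := by
  have h1 : 0 < 1 - exp (-(D / 4)) := by
    have : exp (-(D / 4)) < 1 := exp_lt_one_iff.mpr (by linarith)
    linarith
  exact mul_pos h1 (by linarith)

/-- **A6 NON-VACUITY OF §1 on p606977's uniform-label toy** (classes = old-block counts `0, …, n`, run A `≡ 1`, run B `= e^{D·count}`, exactly quantised `ε = 0`, anti-concentrated at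
level `1∕(n + 1)` — `toy_quantised` ∕ `toy_antiConc` BY NAME): the hypotheses of `exists_classLaw_sub_ge_of_quantised_antiConc` are jointly inhabited and its conclusion then BITES — some set
of counts carries `e^{D·count}`-law minus counting-law mass at least `κ(D, 1∕(n + 1))`. [folklore] -/
theorem toy_classLaw_separated {D : ℝ} (hD : 0 < D) (n : ℕ) :
    ∃ S, S ⊆ range (n + 1) ∧ (1 - exp (-(D / 4))) * ((1 - 1 / ((n : ℝ) + 1) * (1 + exp (3 * D / 4))) / 2) ≤
      (∑ τ ∈ S, exp (D * τ)) / (∑ τ ∈ range (n + 1), exp (D * τ)) - (∑ _τ ∈ S, (1 : ℝ)) / (∑ _τ ∈ range (n + 1), (1 : ℝ)) :=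
  exists_classLaw_sub_ge_of_quantised_antiConc (T := range (n + 1)) (A := fun _ => (1 : ℝ)) (B := fun τ : ℕ => exp (D * τ))
    (v := fun τ : ℕ => (τ : ℤ)) (c₀ := 0) (ε := 0) hD (by linarith) (by positivity) (fun _ _ => zero_le_one)
    (by rw [Finset.sum_const, Finset.card_range, nsmul_eq_mul, mul_one]; positivity) (toy_quantised D n) (toy_antiConc n)

end OneStep

/-! ## §2 Along `K`, at dag-n20-d's dial-free letters: the ROWS text ⇒ dag-n19-w4's `hsep` with `s = κ(D, m)` -/

section AlongK

variable {F : T4Family} {N : ℕ} [NeZero N]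

/-- ★★ **THE ROWS IMPLY LAW SEPARATION AT THE RECORD's KEYED CLASS WEIGHTS** [folklore].  The (Q) ∧ (ACn) ROWS text of `…N20QuantisedRatioNoRescueStubText` (p608344) at
`(θ, hP, K₀, g₀, os)` — some `D > 0`, `ε < D∕4`, `0 ≤ m`, `m(1 + e^{3D∕4}) ≤ 1∕2`, an integer key label `v`, centres `c₀`, and FREQUENTLY IN `K` some admissible source `|t| ≤ 1` with positive
run-A total carrying (Q) ∧ (ACn) — implies dag-n19-w4's LAW-SEPARATION letter `hsep` VERBATIM at `(classSet₁₃ θ K₀ g₀, weightA₁₃ θ hP K₀ g₀ os, weightB₁₃ θ hP K₀ g₀ os)` with the explicit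
size `s = κ(D, m) > 0`.  (`0 ≤ weightA₁₃` is dag-n20-w2's `weightA₁₃_nonneg`.)  Decides neither letter at the record. -/
theorem lawSeparated_of_rows (K₀ : ℕ) (θ : Stage13HParams F N) (hP : θ.Provisos₁₃CoPH F N) (g₀ : ℕ → ℝ) (os : List (ULoop F))
    (hrows : ∃ (D ε m : ℝ) (v : ℕ → ℝ → (Σ K, SiteSeqKey F (K₀ + K)) → ℤ) (c₀ : ℕ → ℝ → ℝ),
      0 < D ∧ ε < D / 4 ∧ 0 ≤ m ∧ m * (1 + exp (3 * D / 4)) ≤ 1 / 2 ∧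
      ∃ᶠ K in atTop, ∃ t : ℝ, |t| ≤ 1 ∧ 0 < ∑ x ∈ classSet₁₃ θ K₀ g₀ K, weightA₁₃ θ hP K₀ g₀ os K t x ∧
        (∀ x ∈ classSet₁₃ θ K₀ g₀ K,
          exp (c₀ K t + D * (v K t x : ℝ) - ε) * weightA₁₃ θ hP K₀ g₀ os K t x ≤ weightB₁₃ θ hP K₀ g₀ os K t x ∧
            weightB₁₃ θ hP K₀ g₀ os K t x ≤ exp (c₀ K t + D * (v K t x : ℝ) + ε) * weightA₁₃ θ hP K₀ g₀ os K t x) ∧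
        (∀ n : ℤ, ∑ x ∈ (classSet₁₃ θ K₀ g₀ K).filter (fun x => v K t x = n), weightA₁₃ θ hP K₀ g₀ os K t x ≤
          m * ∑ x ∈ classSet₁₃ θ K₀ g₀ K, weightA₁₃ θ hP K₀ g₀ os K t x)) :
    ∃ s : ℝ, 0 < s ∧ ∀ K₁ : ℕ, ∃ K, K₁ ≤ K ∧ ∃ t : ℝ, |t| ≤ 1 ∧ ∃ S, S ⊆ classSet₁₃ θ K₀ g₀ K ∧
      s ≤ (∑ x ∈ S, weightB₁₃ θ hP K₀ g₀ os K t x) / (∑ x ∈ classSet₁₃ θ K₀ g₀ K, weightB₁₃ θ hP K₀ g₀ os K t x) -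
          (∑ x ∈ S, weightA₁₃ θ hP K₀ g₀ os K t x) / (∑ x ∈ classSet₁₃ θ K₀ g₀ K, weightA₁₃ θ hP K₀ g₀ os K t x) := by
  obtain ⟨D, ε, m, v, c₀, hD, hεD, hm, hm2, hfreq⟩ := hrows
  refine ⟨_, kappa_pos hD hm2, fun K₁ => ?_⟩
  obtain ⟨K, hK, t, ht, hZA, hQ, hAC⟩ := (frequently_atTop.mp hfreq) K₁
  obtain ⟨S, hS, hκ⟩ := exists_classLaw_sub_ge_of_quantised_antiConc hD hεD hm
    (fun x _ => weightA₁₃_nonneg F θ hP K₀ g₀ os K t x) hZA hQ hAC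
  exact ⟨K, hK, t, ht, S, hS, hκ⟩

/-- ★ **ALONG TUNING: «rows not eventually excluded» ⇒ «(LS) not eventually excluded»** [folklore].  At any Stage-13 tuple and offset `0`: if
`¬ ForSmallCouplings D (g₀ ↦ ∀ os, ¬ ROWS)` (the cofinal rows hypothesis of `…N20StubTwoFalseOfLawSeparated` §5) then `¬ ForSmallCouplings D (g₀ ↦ ∀ os s, 0 < s → ¬ hsep)` (the cofinal (LS)
hypothesis of its §3).  One `ForSmallCouplings.mono` over `lawSeparated_of_rows`.  Consequently p610536's rows H-lemma `stubTwoText_false_of_stubOneText_of_rows` is its (LS) H-lemma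
`stubTwoText_false_of_stubOneText_of_lawSeparated` precomposed with this theorem (one `exact`; not restated). -/
theorem not_forSmallCouplings_lawSeparated_of_rows (θ : Stage13HParams F N) (hP : θ.Provisos₁₃CoPH F N)
    (hrows : ¬ ForSmallCouplings (datumOfRecord₁₃CoPH F N θ hP) fun g₀ => ∀ os : List (ULoop F),
      ¬ ∃ (D ε m : ℝ) (v : ℕ → ℝ → (Σ K, SiteSeqKey F (0 + K)) → ℤ) (c₀ : ℕ → ℝ → ℝ),
        0 < D ∧ ε < D / 4 ∧ 0 ≤ m ∧ m * (1 + exp (3 * D / 4)) ≤ 1 / 2 ∧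
        ∃ᶠ K in atTop, ∃ t : ℝ, |t| ≤ 1 ∧ 0 < ∑ x ∈ classSet₁₃ θ 0 g₀ K, weightA₁₃ θ hP 0 g₀ os K t x ∧
          (∀ x ∈ classSet₁₃ θ 0 g₀ K,
            exp (c₀ K t + D * (v K t x : ℝ) - ε) * weightA₁₃ θ hP 0 g₀ os K t x ≤ weightB₁₃ θ hP 0 g₀ os K t x ∧
              weightB₁₃ θ hP 0 g₀ os K t x ≤ exp (c₀ K t + D * (v K t x : ℝ) + ε) * weightA₁₃ θ hP 0 g₀ os K t x) ∧
          (∀ n : ℤ, ∑ x ∈ (classSet₁₃ θ 0 g₀ K).filter (fun x => v K t x = n), weightA₁₃ θ hP 0 g₀ os K t x ≤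
            m * ∑ x ∈ classSet₁₃ θ 0 g₀ K, weightA₁₃ θ hP 0 g₀ os K t x)) :
    ¬ ForSmallCouplings (datumOfRecord₁₃CoPH F N θ hP) fun g₀ => ∀ (os : List (ULoop F)) (s : ℝ), 0 < s →
      ¬ ∀ K₁ : ℕ, ∃ K, K₁ ≤ K ∧ ∃ t : ℝ, |t| ≤ 1 ∧ ∃ S, S ⊆ classSet₁₃ θ 0 g₀ K ∧
        s ≤ (∑ x ∈ S, weightB₁₃ θ hP 0 g₀ os K t x) / (∑ x ∈ classSet₁₃ θ 0 g₀ K, weightB₁₃ θ hP 0 g₀ os K t x) -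
            (∑ x ∈ S, weightA₁₃ θ hP 0 g₀ os K t x) / (∑ x ∈ classSet₁₃ θ 0 g₀ K, weightA₁₃ θ hP 0 g₀ os K t x) := by
  intro hLS
  refine hrows (hLS.mono fun g₀ hg os hR => ?_)
  obtain ⟨s, hs, hsep⟩ := lawSeparated_of_rows 0 θ hP g₀ os hR
  exact hg os s hs hsep

end AlongK

end Summit.QuantumFields.YangMills.BalabanUVNodes.N20QuantisedRatioLawSeparation

end
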